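import Mathlib
import Summits.NavierStokesRegularity.NavierStokesRegularity.Theorems.FilamentSkeletonRssSkeletonJ1RLiaDefectDerivRef
import Summits.NavierStokesRegularity.NavierStokesRegularity.Theorems.FilamentSkeletonRssSkeletonJ1RLiaDefectSplit
import Summits.NavierStokesRegularity.NavierStokesRegularity.Theorems.FilamentSkeletonRssSkeletonJ1RReferenceInjectivityOfCore

/-!
# Crux `SkeletonJ1R` (stmt-NavierStokesRegularity-23610) · line `streamline_kantorovich_R` · toward stub F2-d (`LiaDefectDerivBL`, v7):
# THE DEFECT ON THE SWITCHED REGION IS THE SWITCH WEIGHT TIMES THE NORMAL PART OF THE STRAND RESIDUALS (identity), AND THE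
# DERIVATIVE OF THE DEFECT EXISTS ALONG THE LIA FRAME (hypotheses discharged from `IsLiaReference` + `SlicedFrame`)

Lead `ns-fsr-lead-23610` g2, `--supports stmt-NavierStokesRegularity-23610 --as helper`.  MODEL rung, NEGATIVE side of the ladder: calculus for a
HYPOTHETICAL filament-type blow-up skeleton; nothing here is a claim about Navier–Stokes regularity; the stub and the crux stay OPEN.

* `IsLiaReference.swDefect_eq_smul_perp_residual` — on the closed switched region `‖x_j τ‖² ≤ 2ℓ²` (where the reference cutoff is `1`) the switched
  normal defect IS `σ₀ • (R − ⟪R,T⟫T)` with `R = c_j A_j − β T × T′ + Σ_{k≠j} c_k (A_k − B_k)` — self strand minus its LIA term plus partner strands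
  minus their datum-line strands (`A_k`, `B_k` the regularised Biot–Savart strand integrals at `x_j τ`; the equality behind the inequality
  `…LiaDefectSplit.IsLiaReference.norm_swDefect_le`).  This is the form whose τ-derivative the F2-d bound estimates on the collar (every residual
  varies there on the scale `≍ ℓ`; the tangential-slip × curvature terms cancel identically and must not be split off).
* `IsLiaReference.norm_ge_half_abs_sub` — linear escape of the reference: `|σ|/2 − ‖x_k 0‖ ≤ ‖x_k σ‖` (tilt `≤ Rb/8 ≤ 1/2`).
* `IsLiaReference.swDefect_hasDerivAt` — along an LIA reference carrying a sliced frame, `τ ↦ swDefect Γ Rb γ α M x j τ` is differentiable at every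
  `τ`, with the reference form of `…LiaDefectDerivRef.swDefect_hasDerivAt_ref` (hypotheses `C²`, unit speed, linear escape discharged).
-/

set_option linter.dupNamespace false -- `NavierStokesRegularity.NavierStokesRegularity` path/namespace repetition is the tree convention

noncomputable section

namespace Summit.NavierStokesRegularity.NavierStokesRegularity.Theorems.SkeletonJ1RFrame

open Set Function Filter MeasureTheory Real Topology
open Literature.Analysis.FluidPDE
open Summit.NavierStokesRegularity.NavierStokesRegularity.Theorems.MatchedKernel
open scoped InnerProductSpace BigOperators

variable {N : ℕ} {Γ Rb ρ lam : ℝ} {p t : Fin N → EuclideanSpace ℝ (Fin 3)} {γ : Fin N → ℝ} {α : ℝ} {s₀ : Fin N → ℝ}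
  {x : Fin N → ℝ → EuclideanSpace ℝ (Fin 3)} {M : EuclideanSpace ℝ (Fin 3) → EuclideanSpace ℝ (Fin 3)}

/-! ## §1 The defect on the switched region as the normal part of the strand residuals (identity) -/

/-- **On the closed switched region the defect is the switch weight times the normal part of the strand residuals**:
for `‖x_j τ‖² ≤ 2ℓ²` (`ℓ = Rb√(Γ log Γ) ≠ 0`, `β = liaCoeff ≠ 0`, sliced model at `λ`, `0 ≤ ρ√Γ`), with `T = x_j′ τ`,
`swDefect x j τ = σ₀ • (R − ⟪R, T⟫T)`, `R = c_j A_j − β T × x_j″ τ + Σ_{k≠j} c_k (A_k − B_k)`. [folklore] -/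
theorem IsLiaReference.swDefect_eq_smul_perp_residual (hx : IsLiaReference Γ Rb p t γ α s₀ x) (hM : SlicedModel Γ ρ lam t x M)
    (hρΓ : 0 ≤ ρ * Real.sqrt Γ) (hℓ : Rb * Real.sqrt (Γ * Real.log Γ) ≠ 0) (j : Fin N) (hβ : liaCoeff Γ γ j ≠ 0) (τ : ℝ)
    (hreg : ‖x j τ‖ ^ 2 ≤ 2 * (Rb * Real.sqrt (Γ * Real.log Γ)) ^ 2) :
    swDefect Γ Rb γ α M x j τ = switchWeight (Rb * Real.sqrt (Γ * Real.log Γ)) 1 (x j τ) •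
      ((((Γ * γ j / (4 * Real.pi)) • (∫ σ : ℝ, ((‖x j τ - x j σ‖ ^ 2 +
          Real.exp (-(1+Real.eulerMascheroniConstant-Real.log 2)) * (1:ℝ)) ^ (3 / 2 : ℝ))⁻¹ • cross (deriv (x j) σ) (x j τ - x j σ)) -
        liaCoeff Γ γ j • cross (deriv (x j) τ) (deriv (deriv (x j)) τ)) +
        ∑ k ∈ Finset.univ.erase j, (Γ * γ k / (4 * Real.pi)) • ((∫ σ : ℝ, ((‖x j τ - x k σ‖ ^ 2 +
          Real.exp (-(1+Real.eulerMascheroniConstant-Real.log 2)) * (1:ℝ)) ^ (3 / 2 : ℝ))⁻¹ • cross (deriv (x k) σ) (x j τ - x k σ)) -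
        ∫ σ : ℝ, ((‖x j τ - datumLine Γ p t s₀ k σ‖ ^ 2 +
          Real.exp (-(1+Real.eulerMascheroniConstant-Real.log 2)) * (1:ℝ)) ^ (3 / 2 : ℝ))⁻¹ • cross (t k) (x j τ - datumLine Γ p t s₀ k σ))) -
      (inner ℝ (((Γ * γ j / (4 * Real.pi)) • (∫ σ : ℝ, ((‖x j τ - x j σ‖ ^ 2 +
          Real.exp (-(1+Real.eulerMascheroniConstant-Real.log 2)) * (1:ℝ)) ^ (3 / 2 : ℝ))⁻¹ • cross (deriv (x j) σ) (x j τ - x j σ)) -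
        liaCoeff Γ γ j • cross (deriv (x j) τ) (deriv (deriv (x j)) τ)) +
        ∑ k ∈ Finset.univ.erase j, (Γ * γ k / (4 * Real.pi)) • ((∫ σ : ℝ, ((‖x j τ - x k σ‖ ^ 2 +
          Real.exp (-(1+Real.eulerMascheroniConstant-Real.log 2)) * (1:ℝ)) ^ (3 / 2 : ℝ))⁻¹ • cross (deriv (x k) σ) (x j τ - x k σ)) -
        ∫ σ : ℝ, ((‖x j τ - datumLine Γ p t s₀ k σ‖ ^ 2 +
          Real.exp (-(1+Real.eulerMascheroniConstant-Real.log 2)) * (1:ℝ)) ^ (3 / 2 : ℝ))⁻¹ • cross (t k) (x j τ - datumLine Γ p t s₀ k σ)))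
        (deriv (x j) τ)) • deriv (x j) τ) := by
  obtain ⟨hC2, hunit, h0, h0', hode⟩ := hx j
  set ℓ := Rb * Real.sqrt (Γ * Real.log Γ) with hℓdef
  set β := liaCoeff Γ γ j with hβdef
  set y := x j τ with hy
  set T := deriv (x j) τ with hT
  have hT1 : ‖T‖ = 1 := hunit τ
  set A : Fin N → EuclideanSpace ℝ (Fin 3) := fun k => ∫ σ : ℝ, ((‖y - x k σ‖ ^ 2 +
      Real.exp (-(1+Real.eulerMascheroniConstant-Real.log 2)) * (1:ℝ)) ^ (3 / 2 : ℝ))⁻¹ • cross (deriv (x k) σ) (y - x k σ) with hA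
  set B : Fin N → EuclideanSpace ℝ (Fin 3) := fun k => ∫ σ : ℝ, ((‖y - datumLine Γ p t s₀ k σ‖ ^ 2 +
      Real.exp (-(1+Real.eulerMascheroniConstant-Real.log 2)) * (1:ℝ)) ^ (3 / 2 : ℝ))⁻¹ • cross (t k) (y - datumLine Γ p t s₀ k σ) with hB
  set c : Fin N → ℝ := fun k => Γ * γ k / (4 * Real.pi) with hc
  change swDefect Γ Rb γ α M x j τ = switchWeight ℓ 1 y •
    ((c j • A j - β • cross T (deriv (deriv (x j)) τ) + ∑ k ∈ Finset.univ.erase j, c k • (A k - B k)) -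
      (inner ℝ (c j • A j - β • cross T (deriv (deriv (x j)) τ) + ∑ k ∈ Finset.univ.erase j, c k • (A k - B k)) T) • T)
  -- on the closed switched region the cutoff is 1
  have hcut : refCutoff ℓ y = 1 := refCutoff_eq_one hℓ hreg
  set W := ambientField Γ p t γ α s₀ j y with hW
  -- the LIA identity `T × W = β • x″`
  have hTW : cross T W = β • deriv (deriv (x j)) τ := by
    have h := hode τ
    rw [iteratedDeriv_succ, iteratedDeriv_one] at h
    rw [← hy, ← hT] at h
    rw [hcut, mul_one, ← hW] at h
    rw [h, smul_smul, mul_inv_cancel₀ hβ, one_smul]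
  have hPW : W - (inner ℝ W T) • T = -(β • cross T (deriv (deriv (x j)) τ)) := by
    rw [perpTo_eq_neg_cross_cross T W hT1, hTW, ← crossCLM_apply T, map_smul, crossCLM_apply]
  -- the true field in terms of the strands
  have htF : trueField Γ γ α x y = (c j • A j + ∑ k ∈ Finset.univ.erase j, c k • (A k - B k)) + W := by
    have hbs : bsField Γ γ x y = ∑ k, c k • A k := by unfold bsField; simp only [hc, hA]
    have hamb : W = (∑ k ∈ Finset.univ.erase j, c k • B k) + (1/2:ℝ) • y - α • cross (EuclideanSpace.single 2 1) y := by
      rw [hW]; unfold ambientField; simp only [hc, hB]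
    unfold trueField
    rw [hbs, hamb, ← Finset.add_sum_erase _ _ (Finset.mem_univ j)]
    simp only [smul_sub, Finset.sum_sub_distrib]
    abel
  -- the defect as the switch weight times the normal part of the true field
  set σw := switchWeight ℓ 1 y with hσw
  have hMy : M y = ((7/4:ℝ) * τ) • T := by rw [hy, hT]; exact hM.apply_ref hρΓ j τ
  have hdef : swDefect Γ Rb γ α M x j τ = σw • (trueField Γ γ α x y - (inner ℝ (trueField Γ γ α x y) T) • T) := by
    unfold swDefect switchedField
    simp only [← hℓdef, ← hy, ← hT, ← hσw, hT1, one_pow, div_one]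
    rw [hMy, perpTo_add, perpTo_smul, perpTo_smul, real_inner_smul_left, real_inner_self_eq_norm_sq, hT1, one_pow, mul_one,
      sub_self, smul_zero, add_zero]
  -- the normal part of the true field
  have hperp : trueField Γ γ α x y - (inner ℝ (trueField Γ γ α x y) T) • T =
      (c j • A j - β • cross T (deriv (deriv (x j)) τ) + ∑ k ∈ Finset.univ.erase j, c k • (A k - B k)) -
        (inner ℝ (c j • A j - β • cross T (deriv (deriv (x j)) τ) + ∑ k ∈ Finset.univ.erase j, c k • (A k - B k)) T) • T := by
    rw [htF, perpTo_add, hPW]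
    have horth : inner ℝ (β • cross T (deriv (deriv (x j)) τ)) T = 0 := by
      rw [real_inner_smul_left, inner_cross_self_left, mul_zero]
    simp only [inner_add_left, inner_sub_left, horth, sub_zero, add_smul]
    abel
  rw [hdef, hperp]

/-! ## §2 The derivative of the defect exists along the LIA frame -/

/-- Linear escape of an LIA reference with datum tilt `≤ Rb/8 ≤ 1/2`: `|σ|/2 − ‖x_k 0‖ ≤ ‖x_k σ‖`. [folklore] -/
theorem IsLiaReference.norm_ge_half_abs_sub (hx : IsLiaReference Γ Rb p t γ α s₀ x) (ht : ∀ k, ‖t k‖ = 1)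
    (htilt : ∀ k σ, ‖deriv (x k) σ - t k‖ ≤ Rb / 8) (hRb : Rb ≤ 4) (k : Fin N) (σ : ℝ) :
    (1/2:ℝ) * |σ| - ‖x k 0‖ ≤ ‖x k σ‖ := by
  have h := abs_param_le_of_nearStraight ((hx k).1.of_le (by norm_num)) (ht k) (θ := Rb / 8) (by linarith) (htilt k) σ
  linarith

/-- **THE SWITCHED NORMAL DEFECT IS DIFFERENTIABLE ALONG AN LIA REFERENCE CARRYING A SLICED FRAME** (existence half of stub F2-d on the frame
of record: `IsLiaReference` + `SlicedFrame Γ ρ λ Rb`, `0 ≤ ρ`, `Rb ≤ 4`, unit datum directions), with the reference form of the derivative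
(`…LiaDefectDerivRef.swDefect_hasDerivAt_ref`). [folklore] -/
theorem IsLiaReference.swDefect_hasDerivAt (hx : IsLiaReference Γ Rb p t γ α s₀ x) (hfr : SlicedFrame Γ ρ lam Rb p t s₀ x M) (hρ : 0 ≤ ρ)
    (hRb : Rb ≤ 4) (ht : ∀ k, ‖t k‖ = 1) (j : Fin N) (τ : ℝ) :
    HasDerivAt (fun τ' : ℝ => swDefect Γ Rb γ α M x j τ')
      ((deriv Real.smoothTransition (1 - (‖x j τ‖ ^ 2 / (Rb * Real.sqrt (Γ * Real.log Γ)) ^ 2 + 1 - 2 * (1:ℝ))) *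
            (-(2 * ⟪x j τ, deriv (x j) τ⟫_ℝ / (Rb * Real.sqrt (Γ * Real.log Γ)) ^ 2))) •
          (trueField Γ γ α x (x j τ) - ⟪trueField Γ γ α x (x j τ), deriv (x j) τ⟫_ℝ • deriv (x j) τ)
        + switchWeight (Rb * Real.sqrt (Γ * Real.log Γ)) 1 (x j τ) •
          (fderiv ℝ (trueField Γ γ α x) (x j τ) (deriv (x j) τ)
            - ⟪fderiv ℝ (trueField Γ γ α x) (x j τ) (deriv (x j) τ), deriv (x j) τ⟫_ℝ • deriv (x j) τ
            - ⟪trueField Γ γ α x (x j τ), deriv (deriv (x j)) τ⟫_ℝ • deriv (x j) τ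
            - ⟪trueField Γ γ α x (x j τ), deriv (x j) τ⟫_ℝ • deriv (deriv (x j)) τ)) τ := by
  classical
  obtain ⟨⟨-, htilt, -, -⟩, hM⟩ := hfr
  have hρΓ : 0 ≤ ρ * Real.sqrt Γ := mul_nonneg hρ (Real.sqrt_nonneg _)
  have hC2 : ∀ k, ContDiff ℝ 2 (x k) := fun k => (hx k).1
  have hunit : ∀ k σ, ‖deriv (x k) σ‖ = 1 := fun k σ => (hx k).2.1 σ
  -- a uniform bound on the waists
  set C0 : ℝ := ∑ k, ‖x k 0‖ with hC0
  have hC0k : ∀ k, ‖x k 0‖ ≤ C0 := fun k =>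
    Finset.single_le_sum (f := fun k => ‖x k 0‖) (fun k _ => norm_nonneg _) (Finset.mem_univ k)
  have hxg : ∀ k σ, (1/2:ℝ) * |σ| - C0 ≤ ‖x k σ‖ := fun k σ =>
    le_trans (by linarith [hC0k k]) (hx.norm_ge_half_abs_sub ht htilt hRb k σ)
  exact swDefect_hasDerivAt_ref hM hρΓ (by norm_num : (0:ℝ) < 1/2) hC2 hunit hxg j τ

end Summit.NavierStokesRegularity.NavierStokesRegularity.Theorems.SkeletonJ1RFrame

end
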